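import Summits.QuantumFields.BalabanUV.T4Continuum.Support.ShellMeasureReadOutsMax
import Summits.QuantumFields.BalabanUV.T4Continuum.Support.ShellMeasureLandauHolonomySkew
import Summits.QuantumFields.BalabanUV.T4Continuum.Support.ShellMeasureLandauCorrectionReal

/-!
# `T4Continuum.ShellMeasureReadOutsRestrict` — ROW S114 «THE u-TUPLE's RESTRICTION LETTER IS DESIGNED»: once the u-tuple's carrier
# is READ as S109's `Ysp Λu η U₀ w w′` (the (19)∕(98) source space), the `Cf`-input RESTRICTION LETTER `ιs : 𝒴 →L[ℂ] (↥Sf → 𝔸)` of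
# the END hosts (census R09, u-tuple) IS the coordinate restriction to the stencil `Sf` — `hι : ‖ιs Y‖ ≤ ‖Y‖` from the weight floor
# `1 ≤ w`, `hιr` from the designed real structure
(cell `pub-balaban`, sub-cell `t4`, spine estimate NE7c (node U5b); NE7c ROUND-2 crew.  AUTHOR: unit `b2b-balaban-t4-ne7c-formalise-leaf-05`
gen 11 (prover-b2b-balaban-t4-ne7c-formalise-leaf-05-g11-0) — NOTE N-ne7cL05g11-1, draft `HOME/t4/b2b-balaban-t4-ne7c-formalise-leaf-05/g11/
ShellMeasureReadOutsRestrict.v0.draft.lean` sha16 b72fc1b018a42c31; owner table `t4/b2b-balaban-t4-ne7c-p1/LEAVES-NE7c-P1.md` ROW S114 :=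
leaf-05-g11 (RULING R-ne7cp1-g37-1 (c4), journal l.22905).  FILED BY COURIER `b2b-balaban-t4-ne7c-formalise-leaf-08` gen 17 (the S109
holder, journal l.23208) after the author's seat closed (l.23167): the Lean declarations below are the author's, BYTE-IDENTICAL to the draft;
only this module docstring was re-headed.  ADDITIVE — imports S109 f1 `ShellMeasureReadOutsMax` (leaf-08-g17, p238765), S22
`ShellMeasureLandauHolonomySkew` (`readOutReal`) and S64 f2 `ShellMeasureLandauCorrectionReal` (`skewPi`) ONLY; [folklore]; two DATA `def`s
(`restrictPi`, `ιsD`), 0 `def … : Prop`, 0 sorry, 0 citation tags)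

HONEST FRAMING.  Finite four-torus programme, rung (B)+1 only — NOT infinite volume, NOT a mass gap, NOT the Clay problem, NOT summit
progress; NE7c (`T4IndicatorShell.ShellWeightBound`) NOT PRINTED, NOT PROVED; «NE7c ⇐ the named binders» (c3).  [folklore] wiring on OUR
designed carrier: nothing of Bałaban's ((46), [Balaban1985BackgroundPropagators] Thm 3.12 — the CONTENT stays in the displayed `Hop hH`)
is asserted or discharged.  HONEST DEPENDENCY (cell): continuum YM on T⁴ ⇐ BetaPertH ∧ nine spine estimates (0/9 proved); BetaPertH ⇐
(D1) ∧ (D4) ∧ CAP+tail; G-an2-4 gates asym, D1 and NE2/3/4.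

CONTENT.  §1 `restrictPi Λ Sf : (↥Λ → 𝔸) →L[ℂ] (↥Sf → 𝔸)` (coordinate restriction through the extension by zero, `extL`), `ιsD Λ Sf η U₀ w w′
: Ysp Λ η U₀ w w′ →L[ℂ] (↥Sf → 𝔸)` (= `restrictPi ∘ flat`), `ιsD_apply`, **`norm_ιsD_le_div`** (`‖ιsD Y‖ ≤ ‖Y‖∕w₀` under a floor `w ≥
w₀ > 0`, S109 f1 `norm_ext_le_div`), **`hι_designed`** (the host's `hι : ∀ Y, ‖ιs Y‖ ≤ ‖Y‖` LITERALLY, from `1 ≤ w`); §2 (C⋆-algebra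
values, as in the hosts) **`ιsD_mem_skewPi`** (the host's `hιr`: every `Y ∈ readOutReal L` restricts into `skewPi ↥Sf` when `L`
contains the untwisted lattice-angle letter `rdOut … c` of every stencil bond `c ∈ Sf` and `η ≠ 0`).  CENSUS (R-ne7cp1-g37-1 (c4)):
consumed BY NAME by S109 f2′ (the v6 top) if the owner rules the ride (it forces the host's `𝔸 := Matrix n n ℂ`, Q-ne7cleaf08-g17-1):
LEAVE `ιs hι hιr`, ENTER the unit floor `1 ≤ w₀` [N] + «`L` contains the stencil letters» [S]; otherwise a standalone certificate.
NOTHING in the countdown moves; NE7c NOT PROVED; spine PROVED 0∕9.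
-/

noncomputable section

namespace Summit.QuantumFields.BalabanUV.T4Continuum.ShellMeasureReadOutsRestrict

open Literature.MathematicalPhysics.QuantumFieldTheory.Balaban1983to89
open B7Prop1Explicit (e U1)
open ShellMeasureCommutatorLocGrad (ext ext_apply_of_mem)
open ShellMeasureCommutatorCovDatum (extL extL_apply covIdx covD)
open ShellMeasureReadOutsMax (Ysp flat rdOut rdOut_apply norm_ext_le_div)
open ShellMeasureLandauHolonomySkew (readOutReal mem_readOutReal)
open ShellMeasureLandauCorrectionReal (skewPi mem_skewPi)

export B7Prop1Explicit (Site)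

variable {d : ℕ} {𝔸 : Type*} [NormedRing 𝔸] [NormedAlgebra ℂ 𝔸]

section Restrict

variable (Λ : Finset (Site d × Fin d)) (Sf : Finset (Site d × Fin d)) (η : ℝ) (U₀ : Site d → Fin d → 𝔸ˣ)
  (w : ↥Λ → ℝ) (w' : ↥(covIdx Λ) → ℝ) [hw : Fact (∀ b, 0 < w b)] [hw' : Fact (∀ i, 0 < w' i)]

/-- THE RESTRICTION TO A STENCIL on the flat space: `A ↦ (c ↦ (ext Λ A) c)` for `c ∈ Sf` (zero off the block), a CLM.
[folklore] -/
def restrictPi : (↥Λ → 𝔸) →L[ℂ] (↥Sf → 𝔸) := ContinuousLinearMap.pi fun c : ↥Sf => extL Λ c.1.1 c.1.2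

omit hw hw' in
/-- Unfolding. [folklore] -/
theorem restrictPi_apply (A : ↥Λ → 𝔸) (c : ↥Sf) : restrictPi Λ Sf A c = ext Λ A c.1.1 c.1.2 := by
  rw [restrictPi, ContinuousLinearMap.pi_apply, extL_apply]

/-- **THE DESIGNED `ιs`**: restriction to the `Cf`-input stencil `Sf`, from the (98) source space. [folklore] -/
def ιsD : Ysp Λ η U₀ w w' →L[ℂ] (↥Sf → 𝔸) := (restrictPi Λ Sf).comp (flat Λ η U₀ w w')

/-- Unfolding. [folklore] -/
theorem ιsD_apply (Y : Ysp Λ η U₀ w w') (c : ↥Sf) : ιsD Λ Sf η U₀ w w' Y c = ext Λ (flat Λ η U₀ w w' Y) c.1.1 c.1.2 := by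
  rw [ιsD, ContinuousLinearMap.comp_apply, restrictPi_apply]

/-- **ROW `hι` DESIGNED**: under a weight floor `w ≥ w₀ > 0`, `‖ιsD Y‖ ≤ ‖Y‖∕w₀` (sup norm on `↥Sf → 𝔸`, each coordinate a
bond value; S109 f1 `norm_ext_le_div`); in particular `‖ιsD Y‖ ≤ ‖Y‖` when `1 ≤ w` — the host's `hι`. [folklore] -/
theorem norm_ιsD_le_div (Y : Ysp Λ η U₀ w w') {w₀ : ℝ} (hw₀ : 0 < w₀) (hfl : ∀ b, w₀ ≤ w b) :
    ‖ιsD Λ Sf η U₀ w w' Y‖ ≤ ‖Y‖ / w₀ := by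
  refine (pi_norm_le_iff_of_nonneg (div_nonneg (norm_nonneg _) hw₀.le)).2 fun c => ?_
  rw [ιsD_apply]
  exact norm_ext_le_div Λ η U₀ w w' Y hw₀ hfl c.1.1 c.1.2

/-- **`hι` LITERALLY** (`∀ Y, ‖ιs Y‖ ≤ ‖Y‖`) from the floor `1 ≤ w`. [folklore] -/
theorem hι_designed (hfl : ∀ b, 1 ≤ w b) : ∀ Y : Ysp Λ η U₀ w w', ‖ιsD Λ Sf η U₀ w w' Y‖ ≤ ‖Y‖ := fun Y => by
  simpa using norm_ιsD_le_div Λ Sf η U₀ w w' Y one_pos hfl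

end Restrict

/-! ## The real-structure row `hιr` from the designed real structure -/

section Real

variable {𝔹 : Type*} [CStarAlgebra 𝔹]
variable (Λ : Finset (Site d × Fin d)) (Sf : Finset (Site d × Fin d)) (η : ℝ) (U₀ : Site d → Fin d → 𝔹ˣ)
  (w : ↥Λ → ℝ) (w' : ↥(covIdx Λ) → ℝ) [hw : Fact (∀ b, 0 < w b)] [hw' : Fact (∀ i, 0 < w' i)]

/-- **ROW `hιr` DESIGNED** (C⋆-algebra values, as in the hosts): if the u-tuple's read-out set `L` contains the untwisted
lattice-angle letter `rdOut … b` of EVERY stencil bond `b ∈ Sf` and `η ≠ 0`, then every `Y ∈ readOutReal L` restricts into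
`skewPi ↥Sf` (each `η • Y(b)` is skew, hence `Y(b)` is). [folklore] -/
theorem ιsD_mem_skewPi (hη : η ≠ 0) {L : Set (Ysp Λ η U₀ w w' →L[ℂ] 𝔹)}
    (hL : ∀ c ∈ Sf, rdOut Λ η U₀ w w' c.1 c.2 ∈ L) {Y : Ysp Λ η U₀ w w'} (hY : Y ∈ readOutReal L) :
    ιsD Λ Sf η U₀ w w' Y ∈ skewPi (𝔸 := 𝔹) ↥Sf := by
  rw [mem_skewPi]
  intro c
  have h := (mem_readOutReal.1 hY) _ (hL c.1 c.2)
  rw [skewAdjoint.mem_iff, rdOut_apply] at h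
  rw [ιsD_apply]
  -- `star (η • X) = η • star X` for a real scalar; cancel `η ≠ 0`
  rw [star_smul, star_trivial, ← smul_neg] at h
  exact smul_right_injective _ hη h

end Real

end Summit.QuantumFields.BalabanUV.T4Continuum.ShellMeasureReadOutsRestrict

end
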